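import Literature.Barriers.CriticalPhenomena.ScaleCovarianceNotMoebius
import Literature.MathematicalPhysics.QuantumFieldTheory.PointwiseOSReconstruction

/-!
# `RotationUpgradeFromTwoPoint` (item stmt-CriticalPhenomena-8367): the CUBIC DECOY

Negative knowledge about the crux
`Summit.CriticalPhenomena.Ising3DConformalLimit.Theses.GaussianScaleMixture.RotationUpgradeFromTwoPoint`
(two-point isotropy of a normalised scale-covariant pointwise limit of the critical Ising correlators
on `ℤ³` upgrades to `O(3)` invariance of all `n`-point functions), standing crux disprover (D-0016),
cycle 1. This file constructs the MODEL-BLIND WITNESS used by `Negative/LoadBearingHypotheses.lean`: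
the barrier witness `ScaleNotMoebius.narrowFamily Δ` of
`Literature.Barriers.CriticalPhenomena.ScaleCovarianceNotMoebius` with its (negative, decaying)
connected four-point bump MODULATED by the cubic-invariant, `O(3)`-breaking angular factor
`aniso x = (∑ᵢⱼₖ ((xᵢ-xⱼ)ₖ)⁴)/(∑ᵢⱼ ‖xᵢ-xⱼ‖²)² ∈ [0,1]`:

  `S₀ = 1`, `S₂ = ‖a-b‖^{-2Δ}` (EXACTLY the round conformal two-point function),
  `S₄ = Wick(S₂) - bump·aniso` on non-coincident quadruples, `0` on coincident ones, `Sₙ = 0` else.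

This file: the definitions (`quartic`, `aniso`, `cubicFamily`), the unfolding lemmas and the
algebra of `quartic`/`sqSum`/`aniso` (translation and dilation invariance, permutation symmetry,
`B₃` invariance, `0 ≤ aniso ≤ 1`, the line formula `quartic (tᵢ • w) = (Σᵢⱼ(tᵢ-tⱼ)⁴)·Σₖwₖ⁴`).
`Negative/CubicDecoySymmetries.lean`: the fourteen structural properties of the decoy (translation,
scale covariance with `Δ`, normalisation, non-degeneracy, round `S₂` = hypothesis (H7) of the crux,
`B₃`, permutation symmetry, positivity, Lebowitz sign, `|U₄| ≤ S₂²`).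
`Negative/CubicDecoyNegatives.lean`: continuity off the diagonals, LATTICE PROVENANCE (the decoy is
the scaling limit of its own sampling on `ℤ³`), and the two decisive negatives — NOT rotation
invariant (collinear quadruple versus the rational direction `u = (3/5,4/5,0)`, `Σₖuₖ⁴ = 337/625`)
and NOT reflection positive (`S₆ ≡ 0 < S₄`).
-/

noncomputable section

namespace Summit.CriticalPhenomena.Ising3DConformalLimit.RotationUpgradeFromTwoPointNegative

open Literature.Probability.LatticeModels Literature.Barriers.CriticalPhenomena
open Literature.MathematicalPhysics.QuantumFieldTheory
open Filter Set Function ScaleNotMoebius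
open scoped Topology

/-- Coordinates of a coordinate-permuted point: `(P_π p)_j = p_{π⁻¹ j}`. [folklore] -/
theorem coordPerm_apply_loc (π : Equiv.Perm (Fin 3)) (p : (EuclideanSpace ℝ (Fin 3))) (j : Fin 3) :
    (LinearIsometryEquiv.piLpCongrLeft 2 ℝ ℝ π p) j = p (π.symm j) := by
  simp [LinearIsometryEquiv.piLpCongrLeft_apply, Equiv.piCongrLeft'_apply]

/-! ## The witness -/

/-- The quartic cubic invariant `∑ᵢ ∑ⱼ ∑ₖ ((xᵢ - xⱼ)ₖ)⁴` of a quadruple. [folklore] -/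
def quartic (x : Fin 4 → (EuclideanSpace ℝ (Fin 3))) : ℝ := ∑ i, ∑ j, ∑ k, ((x i - x j) k) ^ 4

/-- The angular modulation `aniso = quartic / sqSum²` (degree `0`, `B₃`-invariant, not
`O(3)`-invariant). [folklore] -/
def aniso (x : Fin 4 → (EuclideanSpace ℝ (Fin 3))) : ℝ := quartic x / sqSum x ^ 2

open Classical in
/-- **The cubic decoy** with parameter `Δ`: `S₀ = 1`, `S₂ = ‖x₀ - x₁‖^{-2Δ}`,
`S₄ = Wick(S₂) - bump · aniso` on non-coincident configurations and `0` on coincident ones,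
`Sₙ = 0` otherwise. [folklore] -/
def cubicFamily (Δ : ℝ) : CorrFamily 3 := fun n =>
  match n with
  | 0 => fun _ => 1
  | 2 => fun x => twoPt Δ (x 0) (x 1)
  | 4 => fun x => if Function.Injective x then wick Δ x - bump Δ x * aniso x else 0
  | _ => fun _ => 0

/-- Unfolding, `n = 0`. [folklore] -/
theorem cubicFamily_zero (Δ : ℝ) (x : Fin 0 → (EuclideanSpace ℝ (Fin 3))) : cubicFamily Δ 0 x = 1 := rfl

/-- Unfolding, `n = 2`. [folklore] -/
theorem cubicFamily_two (Δ : ℝ) (x : Fin 2 → (EuclideanSpace ℝ (Fin 3))) : cubicFamily Δ 2 x = twoPt Δ (x 0) (x 1) := rfl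

open Classical in
/-- Unfolding, `n = 4`. [folklore] -/
theorem cubicFamily_four (Δ : ℝ) (x : Fin 4 → (EuclideanSpace ℝ (Fin 3))) :
    cubicFamily Δ 4 x = if Function.Injective x then wick Δ x - bump Δ x * aniso x else 0 := rfl

/-- Unfolding, `n = 4`, non-coincident configuration. [folklore] -/
theorem cubicFamily_four_of_injective (Δ : ℝ) {x : Fin 4 → (EuclideanSpace ℝ (Fin 3))} (hx : Function.Injective x) :
    cubicFamily Δ 4 x = wick Δ x - bump Δ x * aniso x := by
  rw [cubicFamily_four, if_pos hx]

/-- Unfolding, `n = 4`, coincident configuration. [folklore] -/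
theorem cubicFamily_four_of_not_injective (Δ : ℝ) {x : Fin 4 → (EuclideanSpace ℝ (Fin 3))}
    (hx : ¬ Function.Injective x) : cubicFamily Δ 4 x = 0 := by
  rw [cubicFamily_four, if_neg hx]

/-! #### Algebra of `quartic`, `sqSum`, `aniso` -/

/-- `quartic` is translation invariant. [folklore] -/
theorem quartic_add (x : Fin 4 → (EuclideanSpace ℝ (Fin 3))) (v : (EuclideanSpace ℝ (Fin 3))) : quartic (fun i => x i + v) = quartic x := by
  simp [quartic]

/-- `quartic` is homogeneous of degree `4`. [folklore] -/
theorem quartic_smul (c : ℝ) (x : Fin 4 → (EuclideanSpace ℝ (Fin 3))) : quartic (fun i => c • x i) = c ^ 4 * quartic x := by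
  simp only [quartic, ← smul_sub, PiLp.smul_apply, smul_eq_mul, mul_pow, Finset.mul_sum]

/-- `quartic ≥ 0`. [folklore] -/
theorem quartic_nonneg (x : Fin 4 → (EuclideanSpace ℝ (Fin 3))) : 0 ≤ quartic x := by
  unfold quartic
  positivity

/-- `quartic` is symmetric in the four points. [folklore] -/
theorem quartic_comp_perm (x : Fin 4 → (EuclideanSpace ℝ (Fin 3))) (σ : Equiv.Perm (Fin 4)) :
    quartic (x ∘ σ) = quartic x := by
  unfold quartic
  simp only [Function.comp_apply]
  calc ∑ i, ∑ j, ∑ k, ((x (σ i) - x (σ j)) k) ^ 4 = ∑ i, ∑ j, ∑ k, ((x (σ i) - x j) k) ^ 4 :=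
        Finset.sum_congr rfl fun i _ => Equiv.sum_comp σ (fun j => ∑ k, ((x (σ i) - x j) k) ^ 4)
    _ = ∑ i, ∑ j, ∑ k, ((x i - x j) k) ^ 4 := Equiv.sum_comp σ (fun i => ∑ j, ∑ k, ((x i - x j) k) ^ 4)

/-- `quartic` is invariant under coordinate permutations of `ℝ³`. [folklore] -/
theorem quartic_coordPerm (π : Equiv.Perm (Fin 3)) (x : Fin 4 → (EuclideanSpace ℝ (Fin 3))) :
    quartic (fun i => LinearIsometryEquiv.piLpCongrLeft 2 ℝ ℝ π (x i)) = quartic x := by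
  unfold quartic
  refine Finset.sum_congr rfl fun i _ => Finset.sum_congr rfl fun j _ => ?_
  rw [← map_sub]
  simp only [coordPerm_apply_loc]
  exact Equiv.sum_comp π.symm (fun k => ((x i - x j) k) ^ 4)

/-- `quartic` is invariant under coordinate sign flips of `ℝ³`. [folklore] -/
theorem quartic_signFlip (ε : Fin 3 → ℤˣ) (R : (EuclideanSpace ℝ (Fin 3)) ≃ₗᵢ[ℝ] (EuclideanSpace ℝ (Fin 3)))
    (hR : ∀ (p : (EuclideanSpace ℝ (Fin 3))) (j : Fin 3), R p j = ((ε j : ℤ) : ℝ) * p j) (x : Fin 4 → (EuclideanSpace ℝ (Fin 3))) :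
    quartic (fun i => R (x i)) = quartic x := by
  unfold quartic
  refine Finset.sum_congr rfl fun i _ => Finset.sum_congr rfl fun j _ =>
    Finset.sum_congr rfl fun k _ => ?_
  rw [← map_sub, hR, mul_pow]
  have hk : (((ε k : ℤ) : ℝ)) ^ 4 = 1 := by
    rcases Int.units_eq_one_or (ε k) with h | h
    · simp [h]
    · simp [h]; norm_num
  rw [hk, one_mul]

/-- `quartic` restricted to a line: `quartic (tᵢ • w) = (∑ᵢⱼ (tᵢ - tⱼ)⁴) · ∑ₖ wₖ⁴`. [folklore] -/
theorem quartic_line (t : Fin 4 → ℝ) (w : (EuclideanSpace ℝ (Fin 3))) :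
    quartic (fun i => t i • w) = (∑ i, ∑ j, (t i - t j) ^ 4) * ∑ k, (w k) ^ 4 := by
  simp only [quartic, ← sub_smul, PiLp.smul_apply, smul_eq_mul, mul_pow]
  rw [Finset.sum_mul]
  refine Finset.sum_congr rfl fun i _ => ?_
  rw [Finset.sum_mul]
  refine Finset.sum_congr rfl fun j _ => ?_
  rw [Finset.mul_sum]

/-- `sqSum` is translation invariant. [folklore] -/
theorem sqSum_add (x : Fin 4 → (EuclideanSpace ℝ (Fin 3))) (v : (EuclideanSpace ℝ (Fin 3))) : sqSum (fun i => x i + v) = sqSum x := by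
  simp [sqSum]

/-- `sqSum` is `O(3)` invariant. [folklore] -/
theorem sqSum_map (R : (EuclideanSpace ℝ (Fin 3)) ≃ₗᵢ[ℝ] (EuclideanSpace ℝ (Fin 3))) (x : Fin 4 → (EuclideanSpace ℝ (Fin 3))) : sqSum (fun i => R (x i)) = sqSum x := by
  simp only [sqSum, ← map_sub, LinearIsometryEquiv.norm_map]

/-- `wick` is `O(3)` invariant. [folklore] -/
theorem wick_map (Δ : ℝ) (R : (EuclideanSpace ℝ (Fin 3)) ≃ₗᵢ[ℝ] (EuclideanSpace ℝ (Fin 3))) (x : Fin 4 → (EuclideanSpace ℝ (Fin 3))) :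
    wick Δ (fun i => R (x i)) = wick Δ x := by
  simp only [wick, twoPt_map]

/-- `bump` is `O(3)` invariant. [folklore] -/
theorem bump_map (Δ : ℝ) (R : (EuclideanSpace ℝ (Fin 3)) ≃ₗᵢ[ℝ] (EuclideanSpace ℝ (Fin 3))) (x : Fin 4 → (EuclideanSpace ℝ (Fin 3))) :
    bump Δ (fun i => R (x i)) = bump Δ x := by
  rw [bump, bump, sqSum_map]

/-- `wick` is translation invariant. [folklore] -/
theorem wick_add (Δ : ℝ) (x : Fin 4 → (EuclideanSpace ℝ (Fin 3))) (v : (EuclideanSpace ℝ (Fin 3))) : wick Δ (fun i => x i + v) = wick Δ x := by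
  simp only [wick, twoPt_add]

/-- `bump` is translation invariant. [folklore] -/
theorem bump_add (Δ : ℝ) (x : Fin 4 → (EuclideanSpace ℝ (Fin 3))) (v : (EuclideanSpace ℝ (Fin 3))) : bump Δ (fun i => x i + v) = bump Δ x := by
  rw [bump, bump, sqSum_add]

/-- `aniso` is translation invariant. [folklore] -/
theorem aniso_add (x : Fin 4 → (EuclideanSpace ℝ (Fin 3))) (v : (EuclideanSpace ℝ (Fin 3))) : aniso (fun i => x i + v) = aniso x := by
  rw [aniso, aniso, quartic_add, sqSum_add]

/-- `aniso` is dilation invariant. [folklore] -/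
theorem aniso_smul {c : ℝ} (hc : 0 < c) (x : Fin 4 → (EuclideanSpace ℝ (Fin 3))) : aniso (fun i => c • x i) = aniso x := by
  rw [aniso, aniso, quartic_smul, sqSum_smul hc, mul_pow, ← pow_mul]
  exact mul_div_mul_left _ _ (pow_ne_zero _ hc.ne')

/-- `aniso` is symmetric in the four points. [folklore] -/
theorem aniso_comp_perm (x : Fin 4 → (EuclideanSpace ℝ (Fin 3))) (σ : Equiv.Perm (Fin 4)) : aniso (x ∘ σ) = aniso x := by
  rw [aniso, aniso, quartic_comp_perm, sqSum_comp_perm]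

/-- `aniso` is invariant under coordinate permutations. [folklore] -/
theorem aniso_coordPerm (π : Equiv.Perm (Fin 3)) (x : Fin 4 → (EuclideanSpace ℝ (Fin 3))) :
    aniso (fun i => LinearIsometryEquiv.piLpCongrLeft 2 ℝ ℝ π (x i)) = aniso x := by
  rw [aniso, aniso, quartic_coordPerm, sqSum_map]

/-- `aniso` is invariant under coordinate sign flips. [folklore] -/
theorem aniso_signFlip (ε : Fin 3 → ℤˣ) (R : (EuclideanSpace ℝ (Fin 3)) ≃ₗᵢ[ℝ] (EuclideanSpace ℝ (Fin 3)))
    (hR : ∀ (p : (EuclideanSpace ℝ (Fin 3))) (j : Fin 3), R p j = ((ε j : ℤ) : ℝ) * p j) (x : Fin 4 → (EuclideanSpace ℝ (Fin 3))) :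
    aniso (fun i => R (x i)) = aniso x := by
  rw [aniso, aniso, quartic_signFlip ε R hR, sqSum_map]

/-- `aniso ≥ 0`. [folklore] -/
theorem aniso_nonneg (x : Fin 4 → (EuclideanSpace ℝ (Fin 3))) : 0 ≤ aniso x :=
  div_nonneg (quartic_nonneg x) (sq_nonneg _)

/-- `∑ₖ vₖ⁴ ≤ ‖v‖⁴` on `ℝ³`. [folklore] -/
theorem sum_pow_four_le (v : (EuclideanSpace ℝ (Fin 3))) : ∑ k, (v k) ^ 4 ≤ (‖v‖ ^ 2) ^ 2 := by
  have hn : ‖v‖ ^ 2 = ∑ k, (v k) ^ 2 := by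
    rw [EuclideanSpace.norm_eq, Real.sq_sqrt (Finset.sum_nonneg fun _ _ => sq_nonneg _)]
    simp [Real.norm_eq_abs, sq_abs]
  rw [hn]
  have key : ∀ k, (v k) ^ 4 ≤ (v k) ^ 2 * ∑ l, (v l) ^ 2 := by
    intro k
    have h1 : (v k) ^ 2 ≤ ∑ l, (v l) ^ 2 :=
      Finset.single_le_sum (f := fun l => (v l) ^ 2) (fun _ _ => sq_nonneg _) (Finset.mem_univ k)
    calc (v k) ^ 4 = (v k) ^ 2 * (v k) ^ 2 := by ring
      _ ≤ (v k) ^ 2 * ∑ l, (v l) ^ 2 := mul_le_mul_of_nonneg_left h1 (sq_nonneg _)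
  calc ∑ k, (v k) ^ 4 ≤ ∑ k, (v k) ^ 2 * ∑ l, (v l) ^ 2 := Finset.sum_le_sum fun k _ => key k
    _ = (∑ k, (v k) ^ 2) ^ 2 := by rw [← Finset.sum_mul]; ring

/-- `quartic ≤ sqSum²`, i.e. `aniso ≤ 1`. [folklore] -/
theorem quartic_le_sqSum_sq (x : Fin 4 → (EuclideanSpace ℝ (Fin 3))) : quartic x ≤ sqSum x ^ 2 := by
  -- termwise `∑ₖ ((xᵢ-xⱼ)ₖ)⁴ ≤ (‖xᵢ-xⱼ‖²)²`, then `∑ aᵢⱼ² ≤ (∑ aᵢⱼ)²` for `aᵢⱼ ≥ 0`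
  have h1 : quartic x ≤ ∑ i, ∑ j, (‖x i - x j‖ ^ 2) ^ 2 :=
    Finset.sum_le_sum fun i _ => Finset.sum_le_sum fun j _ => sum_pow_four_le (x i - x j)
  refine h1.trans ?_
  set a : Fin 4 → Fin 4 → ℝ := fun i j => ‖x i - x j‖ ^ 2 with ha
  have ha0 : ∀ i j, 0 ≤ a i j := fun i j => sq_nonneg _
  have hle : ∀ i j, a i j ≤ sqSum x := fun i j => norm_sub_sq_le_sqSum x i j
  show ∑ i, ∑ j, (a i j) ^ 2 ≤ sqSum x ^ 2
  have hs : sqSum x = ∑ i, ∑ j, a i j := rfl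
  calc ∑ i, ∑ j, (a i j) ^ 2 ≤ ∑ i, ∑ j, a i j * sqSum x :=
        Finset.sum_le_sum fun i _ => Finset.sum_le_sum fun j _ => by
          rw [pow_two]; exact mul_le_mul_of_nonneg_left (hle i j) (ha0 i j)
    _ = sqSum x ^ 2 := by
        rw [hs, pow_two]
        simp only [← Finset.sum_mul]

/-- `aniso ≤ 1`. [folklore] -/
theorem aniso_le_one (x : Fin 4 → (EuclideanSpace ℝ (Fin 3))) : aniso x ≤ 1 := by
  unfold aniso
  rcases eq_or_lt_of_le (sq_nonneg (sqSum x)) with h | h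
  · rw [← h, div_zero]; exact zero_le_one
  · rw [div_le_one h]; exact quartic_le_sqSum_sq x

end Summit.CriticalPhenomena.Ising3DConformalLimit.RotationUpgradeFromTwoPointNegative

end
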